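import Mathlib
import Literature.NumberTheory.LFunctions.ConnesProlateGuess
import Literature.NumberTheory.LFunctions.ProlateUniqueness
import Literature.NumberTheory.LFunctions.ProlateFrobenius
import Literature.NumberTheory.LFunctions.ProlateShooting
import Literature.NumberTheory.LFunctions.ProlateZeroStability
import Literature.NumberTheory.LFunctions.ProlateShootingRange
import Literature.NumberTheory.LFunctions.ProlateExistence
import HarnessLib

/-!
# Existence and uniqueness of the prolate functions `h_{n,λ}` (even `n`)

THIS IS NOT AN RH STATEMENT.  We prove the named fact `existsUnique_isProlateFunction` of
`ConnesProlateGuess.lean`: for every `λ > 0` and every even `n` there is exactly one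
`IsProlateFunction λ n`.  Uniqueness is `IsProlateFunction.existsUnique_of_exists`
(`ProlateUniqueness.lean`).  Existence is a **shooting argument in the eigen-parameter** for the
principal Frobenius solution `u_χ = frobSol λ χ` (`u_χ(λ) = 1`): the zero count
`N(χ) = #{x ∈ (0, λ) : u_χ(x) = 0}` is non-decreasing in `χ` (Sturm comparison), vanishes for `χ ≤ 0`,
is unbounded (Sturm–Picone comparison with sines), is locally constant away from the zeros of
`A(χ) = u_χ(0)` and jumps by exactly one to the right of each such zero.  Hence the thresholds
`c_{k+1} = inf {χ : N(χ) ≥ k+1}` satisfy `A(c_{k+1}) = 0`, `N(c_{k+1}) = k` and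
`(−1)^k u′_{c_{k+1}}(0) > 0` (parity of the zero count), so `B(χ) = u′_χ(0)` changes sign on
`[c_k, c_{k+1}]` (resp. `[0, c_1]`) where `N ≡ k`; at a zero `b` of `B` the even extension of `u_b`
(`ProlateExistence.lean`) is the prolate function with `2k` zeros.

References: [Coddington–Levinson 1955, Ch. 8 §2 Thm 2.1]; [Hartman 2002, Ch. XI §§3–4];
[Slepian–Pollak 1961, §III]; [Connes–Consani–Moscovici 2025, §7 (7.9)–(7.12)].
-/

noncomputable section

open Real Set Filter Topology

namespace Literature.NumberTheory.LFunctions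

variable {lam : ℝ}

/-- The number of zeros of the principal solution `u_χ` in `(0, λ)`.
[cite: CoddingtonLevinson1955, Ch. 8 §2] -/
def frobZeros (lam χ : ℝ) : ℕ := {x | x ∈ Ioo 0 lam ∧ frobSol lam χ x = 0}.ncard

/-- Unfolding `frobZeros`. [folklore] -/
theorem frobZeros_def (lam χ : ℝ) :
    frobZeros lam χ = {x | x ∈ Ioo 0 lam ∧ frobSol lam χ x = 0}.ncard := rfl

/-- `N` is non-decreasing (Sturm comparison). [cite: Hartman2002, Ch. XI §3 Cor 3.1] -/
theorem frobZeros_mono (hlam : 0 < lam) {χ χ' : ℝ} (h : χ ≤ χ') :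
    frobZeros lam χ ≤ frobZeros lam χ' := by
  rcases h.eq_or_lt with rfl | h
  · exact le_rfl
  · exact (isProlateODESol_frobSol hlam χ).ncard_zeros_mono hlam (isProlateODESol_frobSol hlam χ')
      (Icc_subset_Ioo_three hlam) (Icc_subset_Ioo_three hlam) h (finite_zeros_frobSol hlam χ)
      (finite_zeros_frobSol hlam χ')

/-- `N` jumps at the zeros of `A(χ) = u_χ(0)` (strict Sturm comparison).
[cite: Hartman2002, Ch. XI §3 Cor 3.1] -/
theorem frobZeros_lt (hlam : 0 < lam) {χ χ' : ℝ} (h : χ < χ') (h0 : frobSol lam χ 0 = 0) :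
    frobZeros lam χ + 1 ≤ frobZeros lam χ' :=
  (isProlateODESol_frobSol hlam χ).ncard_zeros_lt hlam (isProlateODESol_frobSol hlam χ')
    (Icc_subset_Ioo_three hlam) (Icc_subset_Ioo_three hlam) h (finite_zeros_frobSol hlam χ)
    (finite_zeros_frobSol hlam χ') h0

/-- `N(χ) = 0` for `χ ≤ 0`. [cite: SlepianPollak1961, §III] -/
theorem frobZeros_of_nonpos (hlam : 0 < lam) {χ : ℝ} (hχ : χ ≤ 0) : frobZeros lam χ = 0 := by
  have : {x | x ∈ Ioo 0 lam ∧ frobSol lam χ x = 0} = ∅ :=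
    subset_empty_iff.mp fun x hx ↦
      ((frobSol_pos_of_nonpos hlam hχ x (Ioo_subset_Icc_self hx.1)).ne' hx.2).elim
  rw [frobZeros_def, this, ncard_empty]

/-- `N` is unbounded. [cite: Hartman2002, Ch. XI §3; SlepianPollak1961, §III] -/
theorem le_frobZeros (hlam : 0 < lam) (m : ℕ) :
    m ≤ frobZeros lam (4 * π ^ 2 * lam ^ 4 + 4 * (m : ℝ) ^ 2 * π ^ 2 + 1) :=
  le_ncard_zeros_frobSol hlam m (by linarith) (finite_zeros_frobSol hlam _)

/-- Local behaviour of `N` near `χ₀`: constant if `A(χ₀) ≠ 0`, and between `N(χ₀)` and `N(χ₀) + 1`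
if `A(χ₀) = 0`. [cite: CoddingtonLevinson1955, Ch. 8 §2 Thm 2.1 (proof)] -/
theorem frobZeros_near (hlam : 0 < lam) (χ₀ : ℝ) :
    ∃ ε > 0, ∀ χ, |χ - χ₀| < ε →
      (frobSol lam χ₀ 0 ≠ 0 → frobZeros lam χ = frobZeros lam χ₀) ∧
      (frobSol lam χ₀ 0 = 0 →
        frobZeros lam χ₀ ≤ frobZeros lam χ ∧ frobZeros lam χ ≤ frobZeros lam χ₀ + 1) := by
  have h2 : lam < 2 * lam := by linarith
  have hsub : Icc (χ₀ - 1) (χ₀ + 1) ×ˢ Icc 0 lam ⊆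
      Icc (-(|χ₀| + 1)) (|χ₀| + 1) ×ˢ Icc (lam - lam) (lam + lam) := by
    refine prod_mono (fun χ hχ ↦ ⟨?_, ?_⟩) (fun x hx ↦ ⟨by linarith [hx.1], by linarith [hx.2]⟩)
    · linarith [hχ.1, neg_abs_le χ₀]
    · linarith [hχ.2, le_abs_self χ₀]
  obtain ⟨ε, hε, h⟩ := zeros_ncard_near (U := fun χ x ↦ frobSol lam χ x)
    (U₁ := fun χ x ↦ frobSol₁ lam χ x) (χ₀ := χ₀) hlam
    ((continuousOn_frobSol_uncurry hlam hlam.le h2 (|χ₀| + 1)).mono hsub)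
    ((continuousOn_frobSol₁_uncurry hlam hlam.le h2 (|χ₀| + 1)).mono hsub)
    (fun χ _ x hx ↦ hasDerivAt_frobSol hlam χ (abs_sub_lt_two_mul_of_mem_Icc hlam hx))
    (fun x hx h0 ↦ by
      have hxl : x < lam := lt_of_le_of_ne hx.2 fun h ↦ by
        simp only [h, frobSol_self] at h0; exact one_ne_zero h0
      exact frobSol₁_ne_zero_of_zero hlam χ₀ ⟨by linarith [hx.1], hxl⟩ h0)
    (finite_zeros_frobSol_Icc hlam χ₀) (fun χ _ ↦ finite_zeros_frobSol hlam χ)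
    (by simp only [frobSol_self]; exact one_ne_zero)
  refine ⟨ε, hε, fun χ hχ ↦ ⟨fun hA ↦ (h χ hχ).1 hA, fun hA ↦ ?_⟩⟩
  simp only [frobZeros_def]
  rcases le_or_gt 0 (frobSol₁ lam χ₀ 0 * frobSol lam χ 0) with hs | hs
  · have := ((h χ hχ).2 hA).1 hs
    omega
  · have := ((h χ hχ).2 hA).2 hs
    omega

/-- `χ ↦ u′_χ(0)` is continuous. [cite: CoddingtonLevinson1955, Ch. 1 §7 Thm 7.4] -/
theorem continuous_frobSol₁_zero (hlam : 0 < lam) : Continuous fun χ ↦ frobSol₁ lam χ 0 := by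
  refine continuous_iff_continuousAt.mpr fun χ₀ ↦ ?_
  set M := |χ₀| + 1 with hM
  have hK := continuousOn_frobSol₁_uncurry hlam hlam.le (by linarith : lam < 2 * lam) M
  have hg : ContinuousOn (fun χ ↦ frobSol₁ lam χ 0) (Icc (-M) M) := by
    refine hK.comp (f := fun χ : ℝ ↦ (χ, (0 : ℝ)))
      (continuous_id.prodMk continuous_const).continuousOn fun χ hχ ↦ ⟨hχ, ?_⟩
    exact ⟨by linarith, by linarith⟩
  exact hg.continuousAt (Icc_mem_nhds (by rw [hM]; linarith [neg_abs_le χ₀])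
    (by rw [hM]; linarith [le_abs_self χ₀]))

/-- **The thresholds.**  `c = inf {χ : N(χ) ≥ k + 1}` satisfies `c > 0`, `A(c) = 0`, `N(c) = k`,
`N ≤ k` to the left of `c`, `N ≥ k + 1` to the right, and `(−1)^k u′_c(0) > 0`.
[cite: CoddingtonLevinson1955, Ch. 8 §2 Thm 2.1; Hartman2002, Ch. XI §4 Thm 4.1] -/
theorem frobZeros_threshold (hlam : 0 < lam) (k : ℕ) :
    ∃ c : ℝ, 0 < c ∧ frobSol lam c 0 = 0 ∧ frobZeros lam c = k ∧
      (∀ χ < c, frobZeros lam χ ≤ k) ∧ (∀ χ, c < χ → k + 1 ≤ frobZeros lam χ) ∧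
      0 < (-1) ^ k * frobSol₁ lam c 0 := by
  set S : Set ℝ := {χ | k + 1 ≤ frobZeros lam χ} with hS
  have hne : S.Nonempty := ⟨_, le_frobZeros hlam (k + 1)⟩
  have hbdd : BddBelow S := by
    refine ⟨0, fun χ hχ ↦ ?_⟩
    by_contra h
    push Not at h
    have h1 : k + 1 ≤ frobZeros lam χ := hχ
    rw [frobZeros_of_nonpos hlam h.le] at h1
    omega
  set c := sInf S with hc
  have h_lt : ∀ χ < c, frobZeros lam χ ≤ k := by
    intro χ hχ
    have : χ ∉ S := notMem_of_lt_csInf hχ hbdd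
    simp only [hS, mem_setOf_eq, not_le] at this
    omega
  have h_gt : ∀ χ, c < χ → k + 1 ≤ frobZeros lam χ := by
    intro χ hχ
    obtain ⟨s, hsS, hsχ⟩ := exists_lt_of_csInf_lt hne hχ
    exact le_trans hsS (frobZeros_mono hlam hsχ.le)
  obtain ⟨ε, hε, hnear⟩ := frobZeros_near hlam c
  have hp : |c + ε / 2 - c| < ε := by
    rw [show c + ε / 2 - c = ε / 2 by ring, abs_of_pos (by positivity)]; linarith
  have hm : |c - ε / 2 - c| < ε := by
    rw [show c - ε / 2 - c = -(ε / 2) by ring, abs_neg, abs_of_pos (by positivity)]; linarith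
  have h3 := h_gt (c + ε / 2) (by linarith)
  have h4 := h_lt (c - ε / 2) (by linarith)
  have hA : frobSol lam c 0 = 0 := by
    by_contra hA
    have h1 := (hnear _ hp).1 hA
    have h2 := (hnear _ hm).1 hA
    omega
  have hNc : frobZeros lam c = k := by
    have h1 := (hnear _ hp).2 hA
    have h2 := (hnear _ hm).2 hA
    have h5 := frobZeros_mono hlam (by linarith : c - ε / 2 ≤ c)
    omega
  have hc_pos : 0 < c := by
    by_contra h
    push Not at h
    have := frobSol_pos_of_nonpos hlam h 0 ⟨le_rfl, hlam.le⟩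
    rw [hA] at this
    exact lt_irrefl _ this
  have h0mem : (0 : ℝ) ∈ Ioo (-lam) lam := ⟨by linarith, hlam⟩
  have hB : frobSol₁ lam c 0 ≠ 0 := frobSol₁_ne_zero_of_zero hlam c h0mem hA
  have hsign : 0 ≤ (-1) ^ k * frobSol₁ lam c 0 := by
    refine pow_mul_deriv_nonneg_of_zeros (u := frobSol lam c) hlam (continuousOn_frobSol_Icc hlam c)
      (finite_zeros_frobSol hlam c) hNc (fun z hz h0 ↦ ?_) (by rw [frobSol_self]; exact one_pos) hA
      (hasDerivAt_frobSol hlam c (by rw [sub_zero, abs_of_pos hlam]; linarith))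
    exact ⟨_, frobSol₁_ne_zero_of_zero hlam c ⟨by linarith [hz.1], hz.2⟩ h0,
      hasDerivAt_frobSol hlam c (abs_sub_lt_two_mul_of_mem_Icc hlam (Ioo_subset_Icc_self hz))⟩
  refine ⟨c, hc_pos, hA, hNc, h_lt, h_gt, lt_of_le_of_ne hsign ?_⟩
  exact (mul_ne_zero (pow_ne_zero _ (by norm_num)) hB).symm

/-- **Shooting.**  For every `k` there is a parameter `b` with `u′_b(0) = 0` and exactly `k` zeros of
`u_b` in `(0, λ)`. [cite: CoddingtonLevinson1955, Ch. 8 §2 Thm 2.1; SlepianPollak1961, §III] -/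
theorem exists_frobSol₁_zero_eq (hlam : 0 < lam) (k : ℕ) :
    ∃ b : ℝ, frobSol₁ lam b 0 = 0 ∧ frobZeros lam b = k := by
  obtain ⟨c, hc0, hAc, hNc, hlt, hgt, hsc⟩ := frobZeros_threshold hlam k
  obtain ⟨ℓ, hℓc, hsℓ, hℓN⟩ : ∃ ℓ, ℓ < c ∧ (-1) ^ k * frobSol₁ lam ℓ 0 < 0 ∧
      ∀ χ, ℓ < χ → k ≤ frobZeros lam χ := by
    rcases Nat.eq_zero_or_pos k with rfl | hk
    · exact ⟨0, hc0, by simpa using frobSol₁_zero_neg_of_nonpos hlam le_rfl,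
        fun χ _ ↦ Nat.zero_le _⟩
    · obtain ⟨k', rfl⟩ : ∃ k', k = k' + 1 := ⟨k - 1, by omega⟩
      obtain ⟨ℓ, -, -, hNℓ, -, hgtℓ, hsℓ⟩ := frobZeros_threshold hlam k'
      refine ⟨ℓ, ?_, ?_, hgtℓ⟩
      · by_contra h
        push Not at h
        rcases h.eq_or_lt with h | h
        · rw [h] at hNc; omega
        · have := hgt ℓ h; omega
      · have : (-1 : ℝ) ^ (k' + 1) * frobSol₁ lam ℓ 0 = -((-1) ^ k' * frobSol₁ lam ℓ 0) := by ring
        rw [this]; linarith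
  have hBc : Continuous fun χ ↦ (-1 : ℝ) ^ k * frobSol₁ lam χ 0 :=
    continuous_const.mul (continuous_frobSol₁_zero hlam)
  obtain ⟨b, hb, hgb⟩ : ∃ b ∈ Ioo ℓ c, (-1 : ℝ) ^ k * frobSol₁ lam b 0 = 0 :=
    intermediate_value_Ioo hℓc.le hBc.continuousOn ⟨hsℓ, hsc⟩
  refine ⟨b, ?_, le_antisymm (hlt b hb.2) (hℓN b hb.1)⟩
  rcases mul_eq_zero.mp hgb with h | h
  · exact absurd h (pow_ne_zero _ (by norm_num))
  · exact h

/-- Existence of a prolate function with `2k` zeros. [cite: SlepianPollak1961, §III;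
ConnesConsaniMoscovici2025, §7 (7.9)–(7.12)] -/
theorem exists_isProlateFunction (hlam : 0 < lam) (k : ℕ) :
    ∃ f, IsProlateFunction lam (2 * k) f := by
  obtain ⟨b, hB, hN⟩ := exists_frobSol₁_zero_eq hlam k
  exact exists_isProlateFunction_of_frobSol hlam hB hN

/-- **The named fact `existsUnique_isProlateFunction` holds**: for every `λ > 0` and every even `n`
there is exactly one prolate function `h_{n,λ}` in the sense of `IsProlateFunction`.
[cite: ConnesConsaniMoscovici2025, §7 eqs. (7.9)–(7.12); SlepianPollak1961, §III] -/
theorem existsUnique_isProlateFunction_holds : existsUnique_isProlateFunction := by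
  intro lam hlam n hn
  obtain ⟨k, rfl⟩ := hn
  have h := exists_isProlateFunction hlam k
  rw [two_mul] at h
  exact IsProlateFunction.existsUnique_of_exists h

end Literature.NumberTheory.LFunctions
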